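import Literature.MathematicalPhysics.QuantumFieldTheory.Balaban1983to89.B8Thm4Concrete
import Literature.MathematicalPhysics.QuantumFieldTheory.Balaban1983to89.B8Thm2GaugeFixedKLevel

/-!
# `Balaban1983to89.B8LeafModelZd` — [Balaban1985RegularSpaces] THE GENERAL-BACKGROUND `ℤᵈ × 𝔸` FAMILY AS THE ABSTRACT CARRIER `B8.GFData`,
# AND THEOREM 4 (p. 88) AS THE ABSTRACT LEAF `B8.Thm4Printed` ON IT — modulo Proposition 5 and [4] Theorem 3.3, entered as NAMED SOCKETS

statement-level skeleton of published theorems with citation tags; proofs where landed; nothing here is a claim about the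
Yang–Mills mass gap

PDF held: `paper:balaban1985-cmp99-regular-spaces-gauge-fixing` (journal page = PDF page + 74); pp. 77–83, 88, 94–95.

WHY THIS FILE (cell `pub-ymgap`, seat `pub-ymgap-dag-n05-a` g4, KNIT seat of DAG node N05 = [B8]; a MODEL/PROTOTYPE of NODE 00's Stage 3′
member «X.B8» in the sense of `B8-PIN-DESIGN-g4.md` §1 — node00-def may rename/re-home; count-neutral).  The r1 leaf conjunct t4 is
`B8.Thm4Printed B₁′ fam` over an ABSTRACT `GFData` family; until now its only instances were MODELS at `U₀ = 1` (`B8LeafModelV1`,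
`B8Thm4FlatTorus`).  This file packages the concrete `ℤᵈ × 𝔸` carriers of the Theorem-4 knit AT GENERAL BACKGROUND as a `GFData` member —
backgrounds = all unitary-valued `U₀`, perturbations `U′` (carried together with their background, so that the moving-frame action (1.17)
`U′ ↦ U′^{u⁻¹}` (`mgauge`) is a field), gauge transformations CARRIED BY Ω₀ (`u = 1` off Ω₀, hazard №3), (1.29) `Restr129`, (1.33)/(1.34)
`InAk` (+ the block axial gauge `InAx` at every truncation), (1.35)/(1.66) in the forms the (1.42) lemma and the driver read, (1.38)
**`Landau := IsLandau138W`**, (1.62) `C162` = «`U₁ = e^{iηA}`, `A = (iη)⁻¹ log U₁` self-adjoint, `‖A‖ ≤ B·s·(Lʲη)⁻¹` on the bonds of Ω_j»,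
(1.37) `C137` = «the masked self-adjoint exponent of `U₁` has `|Q_j(U₀, ηA)| < 2dLα₁` on the constraint bonds» — and proves
**`B8.Thm4Printed (5dLB₀) zdGF`** from `B8Thm4Concrete.thm4Body_concrete_uniform` by unfolding the fields, MODULO the four named
sockets `SockP5base` / `SockP5` / `SockP5u` (Proposition 5, (1.107)–(1.109)) and `SockH59` ([4] Thm 3.3, in-edge b9) for every member.

HONEST SCOPE / DECLARED READINGS.  (i) `Pert` carries its background: (1.34) `InAAx α U₀ P` includes `P.1 = U₀`; without it `act` could
not be the moving-frame action.  (ii) `Reg335 := True` ([4] (3.35) is a HYPOTHESIS field not read by Theorem 4; Prop. 6 removes it);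
`fNorm := 0` and the Hölder/Laplacian members of `C136`/`C139` are NOT modelled (Theorem 4 does not read them) — this member serves t4 only;
Theorem 2/8 instances need the pin's full field list (`B8-PIN-DESIGN-g4.md` §1).  (iii) The index carries the member's GEOMETRY including
the admissibility-type clauses the knit consumes (`hbox`, `hclass`, `htower`, the PARTITION clause `hpart`, `k ≥ 1`); it carries NO
Prop-valued socket (the sockets are hypotheses of the theorem, quantified over members — rev-1 soundness).  (iv) `B₁′ = 5dLB₀` with
non-strict `≤` in `C162` (print: `<` with `B′₁ = C′₁B₁`).  Count-neutral; N05 NOT discharged; nothing continuum / ℝ⁴ / OS / mass-gap /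
Clay.  Unit `pub-ymgap-dag-n05-a` (g4), 2026-08-26.
-/

noncomputable section

open NormedSpace

namespace Literature.MathematicalPhysics.QuantumFieldTheory.Balaban1983to89.B8LeafModelZd

open Complex (I)
open MatrixLog B7Prop1Explicit B7Prop2Explicit B7Prop1Local B7Eq92Concrete
open B7Prop2Explicit (C0 c2')
open B7Prop3Flat (c3)
open B8Ineq132 (covDerivFwd InAk)
open B8Eq119TwistedAxial (Restr129 InAx)
open B8Eq184Proof (gaugeExp cfgExp)
open B8Lemma1NonAbelian (mulCfg)
open B8Eq140Level (SideTouches)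
open B8Eq146AExpansion (iEta)
open B7Prop4GeneralLevels (logCovIter linCovIter)
open B8Eq155JBound (Jcur wsup)
open B8ScaledSupNorm (bondNorm msup)
open B8Thm2LogB (blockTop)
open B8Ineq130 (tlo thi)
open B8Eq138LandauZd (IsLandau138W IsLandau146W logCfg)
open B8Prop3GaugeFixedKLevel (mem_unitaryUnits_of_mgauge_eq)
open B8Thm4AtLandau138 (mgauge_mgauge_inv)
open B8Thm4Concrete (thm4Body_concrete_uniform)
open B8Thm4Windows (thm4_windows thm4_windows_extra)
open B8Thm2GaugeFixedKLevel (exists_maskedLogField)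

-- `Site` alone could resolve to the torus sites of `Setup.lean`; re-export the `ℤ^d` sites of `B7Prop1Explicit`.
export B7Prop1Explicit (Site)

variable {d : ℕ}

/-! ## §1 The four sockets, named (Proposition 5 ∃ base / ∃ step / uniqueness; [4] Theorem 3.3) -/

section Sockets

variable {𝔸 : Type*} [CStarAlgebra 𝔸] [Nontrivial 𝔸]

/-- **The Proposition-5 EXISTENCE socket at the base level** (`hP5base` of the knit's driver, support form, guarded by the providers'
threshold `cP` and the datum's (1.33)/(1.34)/(1.35)/(1.66)₀): Proposition 5 (1.107)–(1.108) at one level for the datum «u₁ = 1, U′ = U₁»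
(p. 89), Landau clause = `IsLandau138W`. [cite: Balaban1985RegularSpaces, Prop. 5 (1.107)–(1.108) p.94, p.89] -/
def SockP5base (L : ℕ) (B₀ B₀' cP : ℝ) (η : ℝ) (k : ℕ) (Ω : ℕ → Set (Site d)) (Λs : ℕ → ℕ → Set (Site d)) : Prop :=
  ∀ α₀ α₁ : ℝ, 0 < α₀ → 0 < α₁ → α₀ + α₁ ≤ cP →
      ∀ U₀ U' : Site d → Fin d → 𝔸ˣ, (∀ x κ, U₀ x κ ∈ unitaryUnits 𝔸) → (∀ x κ, U' x κ ∈ unitaryUnits 𝔸) →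
      InAk L k η α₀ Ω U₀ → InAk L k η α₀ Ω (mulCfg U' U₀) → (∀ m, m ≤ k → InAx L m (Λs m) U₀ (mulCfg U' U₀)) →
      (∀ j, j ≤ k → ∀ (z : Site d) (μ : Fin d), (∀ x, InBox (loK L j z) (bondHiK L j z μ) x → x ∈ Ω j) →
        ‖(avgIter L (mulCfg U' U₀) j z μ : 𝔸) - (avgIter L U₀ j z μ : 𝔸)‖ ≤ α₁) →
      (∀ b ∈ {b : Site d × Fin d | SideTouches (Ω 0) b.1 b.2}, ‖((U' b.1 b.2 : 𝔸ˣ) : 𝔸) - 1‖ ≤ α₁) →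
      (∃ (v : Site d → 𝔸ˣ) (lam : Site d → 𝔸), (∀ x, v x ∈ unitaryUnits 𝔸) ∧ (∀ x, x ∉ Ω 0 → v x = 1) ∧
        (∀ j, j ≤ 1 → ∀ b ∈ {b : Site d × Fin d | SideTouches (Ω j) b.1 b.2}, (v b.1 : 𝔸) = ((gaugeExp lam b.1 : 𝔸ˣ) : 𝔸) ∧
        (v (b.1 + e b.2) : 𝔸) = ((gaugeExp lam (b.1 + e b.2) : 𝔸ˣ) : 𝔸)) ∧
        (∀ j, j ≤ 1 → ∀ b ∈ {b : Site d × Fin d | SideTouches (Ω j) b.1 b.2},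
        ‖lam b.1‖ ≤ (8 * B₀' * (5 * (d : ℝ) * L * B₀) * (α₀ + α₁)) ∧ ((L : ℝ) ^ j * η) * ‖covDerivFwd η U₀ b.2 lam b.1‖ ≤ (8 * B₀' * (5 * (d : ℝ) * L * B₀) * (α₀ + α₁))) ∧
        IsLandau138W L 1 η (Ω 0) (Λs 1) U₀ (mgauge U₀ v⁻¹ U') ∧ Restr129 L 1 (Λs 1) U₀ ((1 : Site d → 𝔸ˣ) * v))

/-- **The Proposition-5 EXISTENCE socket at level `m + 1`** (`hP5 m` of the driver, support form, guarded): Proposition 5 for the level-`m`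
datum `(u₁, U₁ = U′^{u₁⁻¹}, A)` of Theorem 4's induction. [cite: Balaban1985RegularSpaces, Prop. 5 (1.107)–(1.108) p.94, Thm 4 p.88] -/
def SockP5 (L : ℕ) (B₀ B₀' cP : ℝ) (η : ℝ) (k : ℕ) (Ω : ℕ → Set (Site d)) (Λs : ℕ → ℕ → Set (Site d)) : Prop :=
  ∀ α₀ α₁ : ℝ, 0 < α₀ → 0 < α₁ → α₀ + α₁ ≤ cP →
      ∀ U₀ U' : Site d → Fin d → 𝔸ˣ, (∀ x κ, U₀ x κ ∈ unitaryUnits 𝔸) → (∀ x κ, U' x κ ∈ unitaryUnits 𝔸) →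
      InAk L k η α₀ Ω U₀ → InAk L k η α₀ Ω (mulCfg U' U₀) → (∀ m, m ≤ k → InAx L m (Λs m) U₀ (mulCfg U' U₀)) →
      (∀ j, j ≤ k → ∀ (z : Site d) (μ : Fin d), (∀ x, InBox (loK L j z) (bondHiK L j z μ) x → x ∈ Ω j) →
        ‖(avgIter L (mulCfg U' U₀) j z μ : 𝔸) - (avgIter L U₀ j z μ : 𝔸)‖ ≤ α₁) →
      (∀ b ∈ {b : Site d × Fin d | SideTouches (Ω 0) b.1 b.2}, ‖((U' b.1 b.2 : 𝔸ˣ) : 𝔸) - 1‖ ≤ α₁) →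
      (∀ m, 1 ≤ m → m < k → ∀ (u₁ : Site d → 𝔸ˣ) (U₁ : Site d → Fin d → 𝔸ˣ) (A : Site d → Fin d → 𝔸),
        (∀ x, u₁ x ∈ unitaryUnits 𝔸) → (∀ x, x ∉ Ω 0 → u₁ x = 1) → mgauge U₀ u₁ U₁ = U' → Restr129 L m (Λs m) U₀ u₁ →
        IsLandau138W L m η (Ω 0) (Λs m) U₀ U₁ →
        (∀ j, j ≤ m → ∀ b ∈ {b : Site d × Fin d | SideTouches (Ω j) b.1 b.2},
        U₁ b.1 b.2 = cfgExp η A b.1 b.2 ∧ IsSelfAdjoint (A b.1 b.2) ∧ ‖A b.1 b.2‖ ≤ (5 * (d : ℝ) * L * B₀ * (α₀ + α₁)) * ((L : ℝ) ^ j * η)⁻¹) →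
        ∃ (v : Site d → 𝔸ˣ) (lam : Site d → 𝔸), (∀ x, v x ∈ unitaryUnits 𝔸) ∧ (∀ x, x ∉ Ω 0 → v x = 1) ∧
        (∀ j, j ≤ m + 1 → ∀ b ∈ {b : Site d × Fin d | SideTouches (Ω j) b.1 b.2}, (v b.1 : 𝔸) = ((gaugeExp lam b.1 : 𝔸ˣ) : 𝔸) ∧
        (v (b.1 + e b.2) : 𝔸) = ((gaugeExp lam (b.1 + e b.2) : 𝔸ˣ) : 𝔸)) ∧
        (∀ j, j ≤ m + 1 → ∀ b ∈ {b : Site d × Fin d | SideTouches (Ω j) b.1 b.2},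
        ‖lam b.1‖ ≤ (8 * B₀' * (5 * (d : ℝ) * L * B₀) * (α₀ + α₁)) ∧ ((L : ℝ) ^ j * η) * ‖covDerivFwd η U₀ b.2 lam b.1‖ ≤ (8 * B₀' * (5 * (d : ℝ) * L * B₀) * (α₀ + α₁))) ∧
        IsLandau138W L (m + 1) η (Ω 0) (Λs (m + 1)) U₀ (mgauge U₀ v⁻¹ U₁) ∧ Restr129 L (m + 1) (Λs (m + 1)) U₀ (u₁ * v))

/-- **The (1.59) socket** = [4] Theorem 3.3 for `G(U₀)` per gauge-fixed field (in-edge b9), in `B8Prop3KLevel`'s `h59a`/`h59g` currency,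
guarded. [cite: Balaban1985RegularSpaces, (1.59) p.86; Balaban1985BackgroundPropagators, Thm 3.3 p.398] -/
def SockH59 (L : ℕ) (B₀ B₀' cP : ℝ) (η : ℝ) (k : ℕ) (Ω : ℕ → Set (Site d)) (Λs : ℕ → ℕ → Set (Site d))
    (Λb : ℕ → ℕ → Set (Site d × Fin d)) : Prop :=
  ∀ α₀ α₁ : ℝ, 0 < α₀ → 0 < α₁ → α₀ + α₁ ≤ cP →
      ∀ U₀ U' : Site d → Fin d → 𝔸ˣ, (∀ x κ, U₀ x κ ∈ unitaryUnits 𝔸) → (∀ x κ, U' x κ ∈ unitaryUnits 𝔸) →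
      InAk L k η α₀ Ω U₀ → InAk L k η α₀ Ω (mulCfg U' U₀) → (∀ m, m ≤ k → InAx L m (Λs m) U₀ (mulCfg U' U₀)) →
      (∀ j, j ≤ k → ∀ (z : Site d) (μ : Fin d), (∀ x, InBox (loK L j z) (bondHiK L j z μ) x → x ∈ Ω j) →
        ‖(avgIter L (mulCfg U' U₀) j z μ : 𝔸) - (avgIter L U₀ j z μ : 𝔸)‖ ≤ α₁) →
      (∀ b ∈ {b : Site d × Fin d | SideTouches (Ω 0) b.1 b.2}, ‖((U' b.1 b.2 : 𝔸ˣ) : 𝔸) - 1‖ ≤ α₁) →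
      (∀ m, 1 ≤ m → m ≤ k → ∀ (u : Site d → 𝔸ˣ) (W : Site d → Fin d → 𝔸ˣ) (A' : Site d → Fin d → 𝔸),
        (∀ x, u x ∈ unitaryUnits 𝔸) → mgauge U₀ u W = U' → Restr129 L m (Λs m) U₀ u → IsLandau138W L m η (Ω 0) (Λs m) U₀ W →
        (∀ y τ, IsSelfAdjoint (A' y τ)) →
        (∀ j, j ≤ m → ∀ y τ, SideTouches (Ω j) y τ →
        W y τ = cfgExp η A' y τ ∧ ‖A' y τ‖ ≤ (2 * (L * (5 * (d : ℝ) * L * B₀ * (α₀ + α₁))) + 8 * (8 * B₀' * (5 * (d : ℝ) * L * B₀) * (α₀ + α₁))) * ((L : ℝ) ^ j * η)⁻¹) →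
        (∀ y τ, (∀ j, j ≤ m → ¬ SideTouches (Ω j) y τ) → A' y τ = 0) →
        msup L m η (-(1 : ℝ)) (fun j (b : Site d × Fin d) => SideTouches (Ω j) b.1 b.2) (fun b => A' b.1 b.2)
        ≤ B₀ * (bondNorm L m η (-(3 : ℝ)) Ω (fun x μ => Jcur η U₀ A' μ x)
        + wsup 1 (fun p : {p : ℕ × (Site d × Fin d) // p.1 ≤ m ∧ p.2 ∈ Λb m p.1} =>
        linCovIter L U₀ (iEta η A') p.1.1 p.1.2.1 p.1.2.2)) ∧
        msup L m η (-(2 : ℝ)) (fun j (t : Fin d × Fin d × Site d) => SideTouches (Ω j) t.2.2 t.2.1)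
        (fun t => covDerivFwd η U₀ t.1 (fun z => A' z t.2.1) t.2.2)
        ≤ B₀ * (bondNorm L m η (-(3 : ℝ)) Ω (fun x μ => Jcur η U₀ A' μ x)
        + wsup 1 (fun p : {p : ℕ × (Site d × Fin d) // p.1 ≤ m ∧ p.2 ∈ Λb m p.1} =>
        linCovIter L U₀ (iEta η A') p.1.1 p.1.2.1 p.1.2.2)))

/-- **The Proposition-5 UNIQUENESS socket** ((1.109) p. 94, radius `cu` = print's c₃) for every restricted datum `u₁`, guarded.
[cite: Balaban1985RegularSpaces, Prop. 5 (1.109) p.94] -/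
def SockP5u (L : ℕ) (cP cu : ℝ) (η : ℝ) (k : ℕ) (Ω : ℕ → Set (Site d)) (Λs : ℕ → ℕ → Set (Site d)) : Prop :=
  ∀ α₀ α₁ : ℝ, 0 < α₀ → 0 < α₁ → α₀ + α₁ ≤ cP →
      ∀ U₀ U' : Site d → Fin d → 𝔸ˣ, (∀ x κ, U₀ x κ ∈ unitaryUnits 𝔸) → (∀ x κ, U' x κ ∈ unitaryUnits 𝔸) →
      InAk L k η α₀ Ω U₀ → InAk L k η α₀ Ω (mulCfg U' U₀) → (∀ m, m ≤ k → InAx L m (Λs m) U₀ (mulCfg U' U₀)) →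
      (∀ j, j ≤ k → ∀ (z : Site d) (μ : Fin d), (∀ x, InBox (loK L j z) (bondHiK L j z μ) x → x ∈ Ω j) →
        ‖(avgIter L (mulCfg U' U₀) j z μ : 𝔸) - (avgIter L U₀ j z μ : 𝔸)‖ ≤ α₁) →
      (∀ b ∈ {b : Site d × Fin d | SideTouches (Ω 0) b.1 b.2}, ‖((U' b.1 b.2 : 𝔸ˣ) : 𝔸) - 1‖ ≤ α₁) →
      ∀ u₁ : Site d → 𝔸ˣ, (∀ x, u₁ x ∈ unitaryUnits 𝔸) → Restr129 L k (Λs k) U₀ u₁ →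
      ∀ (v w : Site d → 𝔸ˣ) (lam mu : Site d → 𝔸),
      (∀ j, j ≤ k → ∀ y ∈ Λs k j, ∀ x : Site d, InBox (tlo L y j) (thi L y j) x →
        ((gaugeExp lam x : 𝔸ˣ) : 𝔸) = ((v x : 𝔸ˣ) : 𝔸) ∧ IsSelfAdjoint (lam x) ∧ ‖lam x‖ < cu ∧
          ∀ κ : Fin d, InBox (tlo L y j) (thi L y j) (x + e κ) → ((L : ℝ) ^ j * η) * ‖covDerivFwd η U₀ κ lam x‖ < cu) →
      (∀ j, j ≤ k → ∀ y ∈ Λs k j, ∀ x : Site d, InBox (tlo L y j) (thi L y j) x →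
        ((gaugeExp mu x : 𝔸ˣ) : 𝔸) = ((w x : 𝔸ˣ) : 𝔸) ∧ IsSelfAdjoint (mu x) ∧ ‖mu x‖ < cu ∧
          ∀ κ : Fin d, InBox (tlo L y j) (thi L y j) (x + e κ) → ((L : ℝ) ^ j * η) * ‖covDerivFwd η U₀ κ mu x‖ < cu) →
      IsLandau138W L k η (Ω 0) (Λs k) U₀ (mgauge U₀ v⁻¹ (mgauge U₀ u₁⁻¹ U')) → Restr129 L k (Λs k) U₀ (u₁ * v) →
      IsLandau138W L k η (Ω 0) (Λs k) U₀ (mgauge U₀ w⁻¹ (mgauge U₀ u₁⁻¹ U')) → Restr129 L k (Λs k) U₀ (u₁ * w) →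
      ∀ j, j ≤ k → ∀ y ∈ Λs k j, ∀ x : Site d, InBox (tlo L y j) (thi L y j) x → v x = w x
end Sockets

/-! ## §2 The member: index (geometry) and the `GFData` packaging -/

section Family

/-- **The index of the general-background `ℤᵈ` family** = the member data of `B8Thm4Concrete.thm4Body_concrete_uniform`: lattice spacing
`η > 0`, number of levels `k ≥ 1`, the region sequence `{Ω_j}` (antitone), the constraint sets `Λs m j` of every truncation `m ≤ k`
(level-`j` coordinates), the constraint-bond classes `Λb` of the (1.42) lemma with their geometry (`hbox`, `hclass`), «`Bʲ(y) ⊂ Ω_j`»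
(`htower`) and the PARTITION clause «Ω₀ ⊂ ⋃ Bʲ(Λ_j)» (`hpart`, p. 81). [cite: Balaban1985RegularSpaces, (1.3)–(1.5) p.77, (1.28)–(1.29) p.81] -/
structure ZdIdx (d L : ℕ) where
  /-- lattice spacing -/
  η : ℝ
  hη : 0 < η
  /-- number of averaging levels -/
  k : ℕ
  hk : 1 ≤ k
  Ω : ℕ → Set (Site d)
  hΩ : ∀ j, Ω (j + 1) ⊆ Ω j
  Λs : ℕ → ℕ → Set (Site d)
  Λb : ℕ → ℕ → Set (Site d × Fin d)
  hbox : ∀ m, m ≤ k → ∀ j, j ≤ m → ∀ c ∈ Λb m j, ∀ x, InBox (loK L j c.1) (bondHiK L j c.1 c.2) x → x ∈ Ω j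
  hclass : ∀ m, m ≤ k → ∀ j, j ≤ m → ∀ c ∈ Λb m j,
      (c.1 ∈ Λs m j ∧ c.1 + e c.2 ∈ Λs m j) ∨
      (∃ j', j = j' + 1 ∧ (∀ x, (L : ℤ) • c.1 ≤ x → x ≤ (L : ℤ) • c.1 + blockTop L → x ∈ Λs m j') ∧ c.1 + e c.2 ∈ Λs m j) ∨
      (∃ j', j = j' + 1 ∧ c.1 ∈ Λs m j ∧ (∀ x, (L : ℤ) • (c.1 + e c.2) ≤ x → x ≤ (L : ℤ) • (c.1 + e c.2) + blockTop L → x ∈ Λs m j'))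
  htower : ∀ j, j ≤ k → ∀ y ∈ Λs k j, ∀ x, InBox (tlo L y j) (thi L y j) x → x ∈ Ω j
  hpart : ∀ x, x ∈ Ω 0 → ∃ j, j ≤ k ∧ ∃ y ∈ Λs k j, InBox (tlo L y j) (thi L y j) x

variable (𝔸 : Type) [CStarAlgebra 𝔸] [Nontrivial 𝔸] (L : ℕ)

/-- **The general-background `ℤᵈ × 𝔸` member as `B8.GFData`** (field-by-field reading in the module docstring; `B8-PIN-DESIGN-g4.md` §1).
[cite: Balaban1985RegularSpaces, (1.29) p.81, (1.33)–(1.38) p.82, (1.62) p.87, (1.66) p.87, (1.17) p.78] -/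
def zdGF (i : ZdIdx d L) : B8.GFData where
  Cfg := {U : Site d → Fin d → 𝔸ˣ // ∀ x κ, U x κ ∈ unitaryUnits 𝔸}
  Pert := {U : Site d → Fin d → 𝔸ˣ // ∀ x κ, U x κ ∈ unitaryUnits 𝔸} × {U : Site d → Fin d → 𝔸ˣ // ∀ x κ, U x κ ∈ unitaryUnits 𝔸}
  GT := {u : Site d → 𝔸ˣ // (∀ x, u x ∈ unitaryUnits 𝔸) ∧ ∀ x, x ∉ i.Ω 0 → u x = 1}
  Src := Site d → 𝔸
  k := i.k
  InA := fun α U₀ => InAk L i.k i.η α i.Ω U₀.1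
  Reg335 := fun _ _ => True
  InAAx := fun α U₀ P => P.1 = U₀ ∧ InAk L i.k i.η α i.Ω (mulCfg P.2.1 U₀.1) ∧ ∀ m, m ≤ i.k → InAx L m (i.Λs m) U₀.1 (mulCfg P.2.1 U₀.1)
  avgClose := fun α U₀ P => ∀ j, j ≤ i.k → ∀ (z : Site d) (μ : Fin d), (∀ x, InBox (loK L j z) (bondHiK L j z μ) x → x ∈ i.Ω j) →
    ‖(avgIter L (mulCfg P.2.1 U₀.1) j z μ : 𝔸) - (avgIter L U₀.1 j z μ : 𝔸)‖ ≤ α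
  avgClose166 := fun α U₀ P => (∀ j, j ≤ i.k → ∀ (z : Site d) (μ : Fin d), (∀ x, InBox (loK L j z) (bondHiK L j z μ) x → x ∈ i.Ω j) →
      ‖(avgIter L (mulCfg P.2.1 U₀.1) j z μ : 𝔸) - (avgIter L U₀.1 j z μ : 𝔸)‖ ≤ α) ∧
    ∀ b ∈ {b : Site d × Fin d | SideTouches (i.Ω 0) b.1 b.2}, ‖((P.2.1 b.1 b.2 : 𝔸ˣ) : 𝔸) - 1‖ ≤ α
  Restricted := fun U₀ u => Restr129 L i.k (i.Λs i.k) U₀.1 u.1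
  act := fun P u => (P.1, ⟨mgauge P.1.1 u.1⁻¹ P.2.1,
    fun x κ => mem_unitaryUnits_of_mgauge_eq P.1.2 P.2.2 u.2.1 (mgauge_mgauge_inv P.1.1 P.2.1 u.1) x κ⟩)
  C136 := fun B₁ _ s U₀ P => ∀ j, j ≤ i.k → ∀ b ∈ {b : Site d × Fin d | SideTouches (i.Ω j) b.1 b.2},
    P.2.1 b.1 b.2 = cfgExp i.η (logCfg i.η P.2.1) b.1 b.2 ∧ IsSelfAdjoint (logCfg i.η P.2.1 b.1 b.2) ∧
      ‖logCfg i.η P.2.1 b.1 b.2‖ ≤ B₁ * s * ((L : ℝ) ^ j * i.η)⁻¹ ∧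
      ∀ κ : Fin d, ((L : ℝ) ^ j * i.η) ^ 2 * ‖covDerivFwd i.η U₀.1 κ (fun z => logCfg i.η P.2.1 z b.2) b.1‖ ≤ B₁ * s
  C137 := fun α₁ U₀ P => ∃ A' : Site d → Fin d → 𝔸, (∀ y τ, IsSelfAdjoint (A' y τ)) ∧
    (∀ j, j ≤ i.k → ∀ y τ, SideTouches (i.Ω j) y τ → P.2.1 y τ = cfgExp i.η A' y τ) ∧
    (∀ y τ, (∀ j, j ≤ i.k → ¬ SideTouches (i.Ω j) y τ) → A' y τ = 0) ∧
    ∀ j, j ≤ i.k → ∀ c ∈ i.Λb i.k j, ‖logCovIter L U₀.1 (iEta i.η A') j c.1 c.2‖ < 2 * d * L * α₁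
  Landau := fun U₀ P => IsLandau138W L i.k i.η (i.Ω 0) (i.Λs i.k) U₀.1 P.2.1
  C139 := fun B s U₀ P => ∀ j, j ≤ i.k → ∀ (y : Site d) (μ : Fin d), SideTouches (i.Ω j) y μ →
    ((L : ℝ) ^ j * i.η) ^ 3 * ‖B8Eq143PlaqExpansion.pdiv i.η U₀.1 (B8Eq146AExpansion.plaqCovDeriv i.η U₀.1 (logCfg i.η P.2.1)) μ y‖
      ≤ B * s
  C162 := fun B s _ P => ∀ j, j ≤ i.k → ∀ b ∈ {b : Site d × Fin d | SideTouches (i.Ω j) b.1 b.2},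
    P.2.1 b.1 b.2 = cfgExp i.η (logCfg i.η P.2.1) b.1 b.2 ∧ IsSelfAdjoint (logCfg i.η P.2.1 b.1 b.2) ∧
      ‖logCfg i.η P.2.1 b.1 b.2‖ ≤ B * s * ((L : ℝ) ^ j * i.η)⁻¹
  fNorm := fun _ => 0
  LandauF := fun U₀ f P => IsLandau146W L i.k i.η (i.Ω 0) (i.Λs i.k) U₀.1 f P.2.1

end Family

/-! ## §3 THEOREM 4 AS THE ABSTRACT LEAF `B8.Thm4Printed` ON THE FAMILY, modulo the named sockets -/

section Thm4

variable {𝔸 : Type} [CStarAlgebra 𝔸] [Nontrivial 𝔸]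

/-- **`B8.Thm4Printed (5dLB₀)` ON THE GENERAL-BACKGROUND `ℤᵈ × 𝔸` FAMILY** (Theorem 4, p. 88, verbatim in `B8.Thm4Printed`), for `d, L ≥ 2`,
`B₀ > 0` with `2 ≤ 5dLB₀` (p. 89 «B₁ not too small»), `B₀′ > 0`, Proposition 5's radius `cu > 0` and the providers' threshold `cP > 0` —
MODULO, for every member, the sockets `SockP5base` / `SockP5` (Prop. 5 ∃, support form), `SockP5u` ((1.109)) and `SockH59` ([4] Thm 3.3,
in-edge b9).  From `B8Thm4Concrete.thm4Body_concrete_uniform` by unfolding the fields of `zdGF`; (1.37) `C137` via the masked exponent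
(`B8Thm2GaugeFixedKLevel.exists_maskedLogField`) and the (1.42) lemma `B8Eq142KLevelLocal.H42_of_inAx`; the windows by `B8Thm4Windows`.
[cite: Balaban1985RegularSpaces, Thm 4 p.88, (1.29) p.81, (1.37)–(1.38) p.82, (1.62) p.87, Prop. 5 p.94, pp.94–95] -/
theorem thm4Printed_zd (hd2 : 2 ≤ d) {L : ℕ} (hL : 2 ≤ L) {B₀ B₀' cu cP : ℝ} (hB₀ : 0 < B₀) (hB₀' : 0 < B₀')
    (hB : 2 ≤ 5 * (d : ℝ) * L * B₀) (hcu : 0 < cu) (hcP : 0 < cP)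
    (SP5base : ∀ i : ZdIdx d L, SockP5base (𝔸 := 𝔸) L B₀ B₀' cP i.η i.k i.Ω i.Λs)
    (SP5 : ∀ i : ZdIdx d L, SockP5 (𝔸 := 𝔸) L B₀ B₀' cP i.η i.k i.Ω i.Λs)
    (SH59 : ∀ i : ZdIdx d L, SockH59 (𝔸 := 𝔸) L B₀ B₀' cP i.η i.k i.Ω i.Λs i.Λb)
    (SP5u : ∀ i : ZdIdx d L, SockP5u (𝔸 := 𝔸) L cP cu i.η i.k i.Ω i.Λs) :
    B8.Thm4Printed (5 * (d : ℝ) * L * B₀) (fun i : ZdIdx d L => zdGF 𝔸 L i) := by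
  have hL1 : 1 ≤ L := le_trans (by norm_num) hL
  have hd1 : 1 ≤ d := le_trans (by norm_num) hd2
  have hL' : (1 : ℝ) ≤ L := by exact_mod_cast hL1
  obtain ⟨c₁, hc₁, H⟩ := thm4Body_concrete_uniform (𝔸 := 𝔸) hd2 hL hB₀ hB₀' hB hcu hcP
  obtain ⟨cw, hcw, hw⟩ := thm4_windows hd1 hL1 hB₀ hB₀' hB
  obtain ⟨cw', hcw', hw'⟩ := thm4_windows_extra (d := d) hL1
  refine ⟨min c₁ (min cw cw'), lt_min hc₁ (lt_min hcw hcw'), ?_⟩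
  intro i α₀ α₁ hα₀ hα₁ hs U₀ P hInA _ hInAAx h166
  have hs₁ : α₀ + α₁ ≤ c₁ := hs.trans (min_le_left _ _)
  have hsw : α₀ + α₁ ≤ cw := hs.trans ((min_le_right _ _).trans (min_le_left _ _))
  have hsw' : α₀ + α₁ ≤ cw' := hs.trans ((min_le_right _ _).trans (min_le_right _ _))
  obtain ⟨hP1, h34, hAx⟩ := hInAAx
  obtain ⟨h135, h66⟩ := h166
  subst hP1
  obtain ⟨u, hu, huS, h129, hLan, hleaf, huniq⟩ := H i.η i.hη i.k i.Ω i.hΩ i.Λs i.Λb i.hbox i.hclass i.htower i.hpart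
    (SP5base i) (SP5 i) (SH59 i) (SP5u i) α₀ α₁ hα₀ hα₁ hs₁ P.1.1 P.2.1 P.1.2 P.2.2 hInA h34 hAx h135 h66
  -- windows for the (1.42) lemma
  obtain ⟨-, -, -, -, w5, w6, w7, -, w9, w10, -, -, -, -, -, -, -, -⟩ :=
    hw α₀ α₁ hα₀ hα₁ hsw (5 * (d : ℝ) * L * B₀ * (α₀ + α₁)) (8 * B₀' * (5 * (d : ℝ) * L * B₀) * (α₀ + α₁)) rfl rfl
  obtain ⟨w19, -⟩ := hw' α₀ α₁ hα₀ hα₁ hsw'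
  have hcs0 : 0 ≤ 5 * (d : ℝ) * L * B₀ * (α₀ + α₁) := by positivity
  have hα₄0 : 0 ≤ 8 * B₀' * (5 * (d : ℝ) * L * B₀) * (α₀ + α₁) := by positivity
  have hKS0 : 0 ≤ 2 * (L * (5 * (d : ℝ) * L * B₀ * (α₀ + α₁))) + 8 * (8 * B₀' * (5 * (d : ℝ) * L * B₀) * (α₀ + α₁)) := by
    positivity
  have hcK : 5 * (d : ℝ) * L * B₀ * (α₀ + α₁) ≤
      2 * (L * (5 * (d : ℝ) * L * B₀ * (α₀ + α₁))) + 8 * (8 * B₀' * (5 * (d : ℝ) * L * B₀) * (α₀ + α₁)) := by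
    have h₁ : (1 : ℝ) * (5 * (d : ℝ) * L * B₀ * (α₀ + α₁)) ≤ L * (5 * (d : ℝ) * L * B₀ * (α₀ + α₁)) :=
      mul_le_mul_of_nonneg_right hL' hcs0
    linarith
  have hc16 : 16 * (5 * (d : ℝ) * L * B₀ * (α₀ + α₁)) ≤ 1 := by linarith
  -- the gauge-fixed field and its masked exponent
  have hW : mgauge P.1.1 u (mgauge P.1.1 u⁻¹ P.2.1) = P.2.1 := mgauge_mgauge_inv P.1.1 P.2.1 u
  have hWu : ∀ x κ, mgauge P.1.1 u⁻¹ P.2.1 x κ ∈ unitaryUnits 𝔸 := mem_unitaryUnits_of_mgauge_eq P.1.2 P.2.2 hu hW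
  have hWA : ∀ j, j ≤ i.k → ∀ y τ, SideTouches (i.Ω j) y τ →
      mgauge P.1.1 u⁻¹ P.2.1 y τ = cfgExp i.η (logCfg i.η (mgauge P.1.1 u⁻¹ P.2.1)) y τ ∧
        ‖logCfg i.η (mgauge P.1.1 u⁻¹ P.2.1) y τ‖ ≤ (5 * (d : ℝ) * L * B₀ * (α₀ + α₁)) * ((L : ℝ) ^ j * i.η)⁻¹ :=
    fun j hj y τ h => ⟨(hleaf j hj (y, τ) h).1, (hleaf j hj (y, τ) h).2.2⟩
  obtain ⟨A', hA'sa, hA'eq, hA'zero⟩ := exists_maskedLogField i.hη hL1 i.k P.1.1 hWu hcs0 hc16 i.Ω hWA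
  have hA'bd : ∀ j, j ≤ i.k → ∀ y τ, SideTouches (i.Ω j) y τ →
      mgauge P.1.1 u⁻¹ P.2.1 y τ = cfgExp i.η A' y τ ∧
        ‖A' y τ‖ ≤ (2 * (L * (5 * (d : ℝ) * L * B₀ * (α₀ + α₁))) + 8 * (8 * B₀' * (5 * (d : ℝ) * L * B₀) * (α₀ + α₁))) *
          ((L : ℝ) ^ j * i.η)⁻¹ := by
    intro j hj y τ h
    obtain ⟨hAA, hWexp⟩ := hA'eq j hj y τ h
    refine ⟨hWexp, ?_⟩
    rw [hAA]
    have hη0 : 0 ≤ i.η := i.hη.le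
    exact ((hWA j hj y τ h).2).trans (mul_le_mul_of_nonneg_right hcK (by positivity))
  have h137 := B8Eq142KLevelLocal.H42_of_inAx hd2 i.hη hL i.k P.1.2 hα₀ hα₁ hKS0 w5 w6 w7 w9 w10 w19 i.Ω i.hΩ i.Λs i.Λb i.hbox
    i.hclass hInA h34 hAx h135 (fun m W => IsLandau138W L m i.η (i.Ω 0) (i.Λs m) P.1.1 W) i.k i.hk le_rfl u
    (mgauge P.1.1 u⁻¹ P.2.1) A' hu hW h129 (hLan i.hk) hA'sa hA'bd hA'zero
  refine ⟨⟨u, hu, huS⟩, h129, ⟨⟨A', hA'sa, fun j hj y τ h => (hA'eq j hj y τ h).2, hA'zero, h137⟩, hLan i.hk, ?_⟩, ?_⟩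
  · intro j hj b hb
    exact hleaf j hj b hb
  · intro u' hR' _ hLan' h162'
    apply Subtype.ext
    refine huniq u'.1 u'.2.1 u'.2.2 hR' hLan' ⟨logCfg i.η (mgauge P.1.1 u'.1⁻¹ P.2.1), fun j hj x κ h => ?_⟩ i.hk
    exact ⟨(h162' j hj (x, κ) h).1, (h162' j hj (x, κ) h).2.2⟩

end Thm4

#print axioms thm4Printed_zd

end Literature.MathematicalPhysics.QuantumFieldTheory.Balaban1983to89.B8LeafModelZd

end
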